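import Mathlib
import HarnessLib
import Summits.Ventures.LatticeQCDFlow.Exactness.NCMCGeneralSpaceGammaMethodWindow

/-!
# THE Γ-METHOD ESTIMATOR OF THE ASYMPTOTIC VARIANCE IS CONSISTENT under a Doeblin POWER, from ANY start: `E_{μ₀}[(2 Γ̂_N(0) τ̂_{N,W} − σ²_f)²] = O(W³/N) + O((1 − ε)^{2⌊(W+1)/m⌋})`, so `2 Γ̂_N(0) τ̂_{N,W_N} → σ²_f` in probability for every deterministic window `W_N → ∞` with `W_N³/N → 0`

HONEST FRAMING: exact (Metropolis-corrected) sampling algorithms for lattice gauge theory;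
figures of merit are autocorrelation/cost numbers at stated couplings and volumes; no
continuum-physics claim.

Venture `LatticeQCDFlow` (cell pub-lqcd), topic `Exactness`; FANOUT row 13 (`eng-snf`, GEN-20).
NEW WORK of the cell, not a published result; no definition is introduced; nothing is cited as a
fact (consistency of truncated / lag-window autocovariance estimators of the spectral density at zero
— Anderson 1971 Ch. 9, Priestley 1981 §6.2; for MCMC, Geyer 1992 §3 and the Γ-method of Wolff 2004 —
NAMED ONLY).  GEN-19's list of things NOT typed began with "a CONSISTENT estimator of `τ_int` / of the
Green–Kubo variance along the chain"; row 8's batch-means estimator (`Scoring/BatchMeansConsistency.lean`)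
needs a ONE-step minorisation, and the cell's scorers do not print batch means but the Γ-method.  THIS
FILE: scorer A's windowed statistic (row 11's verbatim typing `Scoring/SampleACFSumZero.lean`) — at a
DETERMINISTIC window `W` —
`σ̂²_{N,W} = Γ̂_N(0) + 2 Σ_{t=1}^{W} Γ̂_N(t) = Γ̂_N(0) · 2 τ̂_{N,W}` (`τ̂_{N,W} = tauIntWindow ρ̂_N W`, the
printed `tau_int_W`) estimates the Green–Kubo asymptotic variance
`σ²_f = C_f̄(0) + 2 Σ_{t≥1} C_f̄(t)` of the chain CLT (`NCMCGeneralSpaceDoeblinPowerCLT.lean`, row 8's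
`Scoring.markovChain_clt` form) with mean-square error
`≤ (3 + 12W²) K₀/N + 12288 C⁴ W³/N + 768 C⁴ (m/e)² (1 − e)^{2⌊(W+1)/m⌋}`
(`K₀ = C⁴ (2112 + 4224 m/e + 512 (m/e)²)`) for every `N ≥ 2W`, UNIFORMLY IN THE INITIAL LAW — the
per-lag mean-square errors of `NCMCGeneralSpaceGammaMethodMSE.lean` summed over the window (Cauchy–Schwarz)
plus the squared truncation tail `2 Σ_{t>W} |C_f̄(t)| ≤ 2 (2C)² (m/e) (1 − e)^{⌊(W+1)/m⌋}` of the Doeblin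
envelope.  Hence for every window sequence `W_N → ∞` with `W_N³/N → 0` the statistic converges to `σ²_f`
IN PROBABILITY under `P_{μ₀}` for EVERY `μ₀` (Chebyshev) — a consistent, regeneration-free estimator of
the asymptotic variance for every exact sampler of the cell whose certificate is a Doeblin power (the
NCMC lane, `m = 2`; composites), and the input that turns the conservative coverage statements of
`NCMCGeneralSpaceIntervalCoverage.lean` into exact ones (`NCMCGeneralSpaceGammaMethodStudentizedCLT.lean`).

## Content (`κ` Markov, `π` invariant, `(nHit κ m)(x, ·) ≥ ε ν`, `0 < ε ≤ 1`, `0 < m`, `e = ε.toReal`;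
## `|f| ≤ C` measurable, `f̄ = f − πf`, `C_f̄ = Scoring.autocov κ π f̄`; every `μ₀`; `y = f ∘ X`)

(the envelope tail, the identity `Γ̂(0) + 2Σ_{t<W} Γ̂(t+1) = Γ̂(0) · 2 τ̂_W` on every path and the
pointwise splitting are `NCMCGeneralSpaceGammaMethodWindow.lean`)
* **`chain_mse_gammaWindow_le_of_nHit`** — THE MEAN-SQUARE ERROR BOUND above (`2W ≤ N`, `0 < N`).
* **`chain_gammaWindow_tendstoInMeasure_of_nHit`** — for `W_N → ∞` with `W_N³/N → 0`:
  `TendstoInMeasure P_{μ₀} (N ↦ Γ̂_N(0) · 2 τ̂_{N,W_N}) atTop (fun _ => σ²_f)`.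

NOT CLAIMED: the AUTOMATIC (data-dependent) window of Madras–Sokal / Wolff (`Scoring/WolffWindow`,
`Scoring/MadrasSokalWindow`) — only deterministic windows; the optimal window or the sharp rate; the
bias-corrected and replica-pooled variants; almost-sure consistency; unbounded observables; any `ε`, `τ`
or number of ours.
-/

namespace Summit.Ventures.LatticeQCDFlow.Exactness.GeneralNCMC

open MeasureTheory ProbabilityTheory Set Filter Finset
open scoped ENNReal Topology

variable {S : Type*} [MeasurableSpace S]

/-! ## §3 The mean-square error of the windowed statistic and its consistency -/

section Chain

variable {κ : Kernel S S} [IsMarkovKernel κ] {ν : Measure S} [IsProbabilityMeasure ν] {ε : ℝ≥0∞}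
  {π : Measure S} [IsProbabilityMeasure π] {m : ℕ} (μ₀ : Measure S) [IsProbabilityMeasure μ₀]

/-- **THE MEAN-SQUARE ERROR OF THE Γ-METHOD ESTIMATOR OF THE ASYMPTOTIC VARIANCE, ANY START.**
`κ` Markov, `π` invariant, `(nHit κ m)(x, ·) ≥ ε ν` (`0 < ε ≤ 1`, `0 < m`), `|f| ≤ C` measurable,
`f̄ = f − πf`; for every initial law `μ₀`, every `N > 0` and every window `W` with `2W ≤ N`:
`E_{μ₀}[(Γ̂_N(0) + 2 Σ_{t<W} Γ̂_N(t+1) − (C_f̄(0) + 2 Σ'_t C_f̄(t+1)))²]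
 ≤ (3 + 12 W²) K₀/N + 12288 C⁴ W³/N + 768 C⁴ (m/e)² (1 − e)^{2⌊(W+1)/m⌋}`,
`K₀ = C⁴ (2112 + 4224 m/e + 512 (m/e)²)`. -/
theorem chain_mse_gammaWindow_le_of_nHit
    (hmin : ∀ x {B : Set S}, MeasurableSet B → ε * ν B ≤ nHit κ m x B) (hε0 : 0 < ε) (hε1 : ε ≤ 1)
    (hm : 0 < m) (hπ : Kernel.Invariant κ π) {f : S → ℝ} (hf : Measurable f) {C : ℝ}
    (hC : ∀ x, |f x| ≤ C) {N W : ℕ} (hWN : 2 * W ≤ N) (hN : 0 < N) :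
    ∫ x, (Scoring.gammaHat (fun i => f (x i)) N 0
          + 2 * ∑ t ∈ range W, Scoring.gammaHat (fun i => f (x i)) N (t + 1)
        - (Scoring.autocov κ π (fun y => f y - ∫ z, f z ∂π) 0
          + 2 * ∑' t, Scoring.autocov κ π (fun y => f y - ∫ z, f z ∂π) (t + 1))) ^ 2
        ∂(Kernel.trajMeasure (X := fun _ : ℕ => S) μ₀
        (fun n : ℕ => κ.comap (fun h : (i : ↥(Finset.Iic n)) → S => h ⟨n, Finset.mem_Iic.2 le_rfl⟩)
          (measurable_pi_apply _)))
      ≤ (3 + 12 * (W : ℝ) ^ 2) * (C ^ 4 * (2112 + 4224 * m / ε.toReal + 512 * (m / ε.toReal) ^ 2)) / N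
        + 12288 * C ^ 4 * (W : ℝ) ^ 3 / N
        + 768 * C ^ 4 * (m / ε.toReal) ^ 2 * (1 - ε.toReal) ^ (2 * ((W + 1) / m)) := by
  set P := Kernel.trajMeasure (X := fun _ : ℕ => S) μ₀
      (fun n : ℕ => κ.comap (fun h : (i : ↥(Finset.Iic n)) → S => h ⟨n, Finset.mem_Iic.2 le_rfl⟩)
        (measurable_pi_apply _)) with hP
  have hεtop : ε ≠ ∞ := ne_top_of_le_ne_top ENNReal.one_ne_top hε1
  have hεpos : 0 < ε.toReal := ENNReal.toReal_pos hε0.ne' hεtop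
  have hr0 : 0 ≤ 1 - ε.toReal :=
    sub_nonneg.2 (ENNReal.toReal_le_of_le_ofReal zero_le_one (by simpa using hε1))
  have hC0 : 0 ≤ C := (abs_nonneg _).trans (hC (Classical.choice (nonempty_of_isProbabilityMeasure μ₀)))
  have hN' : (0 : ℝ) < N := by exact_mod_cast hN
  set c := ∫ z, f z ∂π with hc
  set Cf : ℕ → ℝ := fun t => Scoring.autocov κ π (fun y => f y - c) t with hCf
  -- the tail
  have hsum : Summable fun t => Cf (t + 1) :=
    summable_autocov_centred_succ_of_nHit hmin hε0 hε1 hm hπ hf hC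
  set T : ℝ := ∑' t, Cf (t + W + 1) with hT
  have hsplit : ∑' t, Cf (t + 1) = ∑ t ∈ range W, Cf (t + 1) + T := by
    rw [hT, ← hsum.sum_add_tsum_nat_add W]
  have hTb : |T| ≤ 2 * (2 * C) ^ 2 * (m / ε.toReal) * (1 - ε.toReal) ^ ((W + 1) / m) := by
    have hsumT : Summable fun t => Cf (t + W + 1) := by
      have h := (summable_nat_add_iff W).2 hsum
      refine h.congr fun t => ?_
      show Cf (t + W + 1) = Cf (t + W + 1)
      rfl
    calc |T| ≤ ∑' t, |Cf (t + W + 1)| := by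
          rw [hT, ← Real.norm_eq_abs]
          have h := norm_tsum_le_tsum_norm hsumT.norm
          simpa only [Real.norm_eq_abs] using h
      _ ≤ 2 * (2 * C) ^ 2 * (m / ε.toReal) * (1 - ε.toReal) ^ ((W + 1) / m) :=
          tsum_abs_autocov_shift_le_of_nHit hmin hε0 hε1 hm hπ hf hC W
  -- per-lag mean-square errors, with `K t = C⁴ (2112 + 1024 t + 4224 m/e + 512 (m/e)²)`
  set K : ℕ → ℝ := fun t =>
    C ^ 4 * (2112 + 1024 * (t : ℝ) + 4224 * m / ε.toReal + 512 * (m / ε.toReal) ^ 2) with hKdef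
  have hK : ∀ t, 2 * t ≤ N → ∫ x, (Scoring.gammaHat (fun i => f (x i)) N t - Cf t) ^ 2 ∂P ≤ K t / N := by
    intro t ht
    have h := chain_mse_gammaHat_le_of_nHit μ₀ hmin hε0 hε1 hm hπ hf hC ht hN
    rw [← hP] at h
    exact h
  have hC4 : 0 ≤ C ^ 4 := by positivity
  have hKmono : ∀ a b : ℕ, a ≤ b → K a ≤ K b := by
    intro a b hab
    have hab' : (a : ℝ) ≤ b := by exact_mod_cast hab
    simp only [hKdef]
    exact mul_le_mul_of_nonneg_left (by linarith) hC4
  have hW0 : (0 : ℝ) ≤ W := Nat.cast_nonneg W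
  have hint := integral_sq_windowSum_sub_le P
    (G := fun t (x : ℕ → S) => Scoring.gammaHat (fun i => f (x i)) N t)
    (fun t => measurable_gammaHat_comp hf N t) (fun t x => abs_gammaHat_comp_le hC x N t) Cf T W
  -- the window sum of the per-lag bounds
  have hsumle : ∑ t ∈ range W, ∫ x, (Scoring.gammaHat (fun i => f (x i)) N (t + 1) - Cf (t + 1)) ^ 2 ∂P
      ≤ W * (K W / N) := by
    have h := Finset.sum_le_card_nsmul (range W)
      (fun t : ℕ => ∫ x, (Scoring.gammaHat (fun i => f (x i)) N (t + 1) - Cf (t + 1)) ^ 2 ∂P)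
      (K W / N) fun t ht => by
        have ht' : t + 1 ≤ W := Finset.mem_range.1 ht
        exact (hK (t + 1) (by omega)).trans
          (div_le_div_of_nonneg_right (hKmono _ _ ht') hN'.le)
    rwa [Finset.card_range, nsmul_eq_mul] at h
  have hT2 : T ^ 2 ≤ 64 * C ^ 4 * (m / ε.toReal) ^ 2 * (1 - ε.toReal) ^ (2 * ((W + 1) / m)) := by
    have h := sq_le_sq' (by linarith [neg_abs_le T, hTb, abs_nonneg T]) ((le_abs_self T).trans hTb)
    refine h.trans (le_of_eq ?_)
    rw [pow_mul']
    ring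
  rw [hsplit]
  refine hint.trans ?_
  calc 3 * ∫ x, (Scoring.gammaHat (fun i => f (x i)) N 0 - Cf 0) ^ 2 ∂P
        + 12 * ((W : ℝ) * ∑ t ∈ range W,
          ∫ x, (Scoring.gammaHat (fun i => f (x i)) N (t + 1) - Cf (t + 1)) ^ 2 ∂P)
        + 12 * T ^ 2
    _ ≤ 3 * (K 0 / N) + 12 * ((W : ℝ) * (W * (K W / N)))
        + 12 * (64 * C ^ 4 * (m / ε.toReal) ^ 2 * (1 - ε.toReal) ^ (2 * ((W + 1) / m))) :=
        add_le_add (add_le_add (mul_le_mul_of_nonneg_left (hK 0 (by omega)) (by norm_num))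
          (mul_le_mul_of_nonneg_left (mul_le_mul_of_nonneg_left hsumle hW0) (by norm_num)))
          (mul_le_mul_of_nonneg_left hT2 (by norm_num))
    _ = (3 + 12 * (W : ℝ) ^ 2) * (C ^ 4 * (2112 + 4224 * m / ε.toReal + 512 * (m / ε.toReal) ^ 2)) / N
        + 12288 * C ^ 4 * (W : ℝ) ^ 3 / N
        + 768 * C ^ 4 * (m / ε.toReal) ^ 2 * (1 - ε.toReal) ^ (2 * ((W + 1) / m)) := by
        simp only [hKdef]
        push_cast
        ring

/-- **THE Γ-METHOD ESTIMATOR IS CONSISTENT, FROM EVERY INITIAL LAW.**  `κ` Markov, `π` invariant,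
`(nHit κ m)(x, ·) ≥ ε ν` (`0 < ε ≤ 1`, `0 < m`), `|f| ≤ C` measurable, `f̄ = f − πf`; `W_N → ∞` with
`W_N³/N → 0`.  Then for EVERY initial law `μ₀`, scorer A's statistic `Γ̂_N(0) · 2 τ̂_{N,W_N}`
(`τ̂_{N,W} = tauIntWindow (rhoHat (f ∘ X) N) W`) converges IN PROBABILITY under `P_{μ₀}` to the
Green–Kubo asymptotic variance `σ²_f = C_f̄(0) + 2 Σ'_t C_f̄(t+1)`. -/
theorem chain_gammaWindow_tendstoInMeasure_of_nHit
    (hmin : ∀ x {B : Set S}, MeasurableSet B → ε * ν B ≤ nHit κ m x B) (hε0 : 0 < ε) (hε1 : ε ≤ 1)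
    (hm : 0 < m) (hπ : Kernel.Invariant κ π) {f : S → ℝ} (hf : Measurable f) {C : ℝ}
    (hC : ∀ x, |f x| ≤ C) {W : ℕ → ℕ} (hW : Tendsto W atTop atTop)
    (hW3 : Tendsto (fun N => (W N : ℝ) ^ 3 / N) atTop (𝓝 0)) :
    TendstoInMeasure (Kernel.trajMeasure (X := fun _ : ℕ => S) μ₀
        (fun n : ℕ => κ.comap (fun h : (i : ↥(Finset.Iic n)) → S => h ⟨n, Finset.mem_Iic.2 le_rfl⟩)
          (measurable_pi_apply _)))
      (fun (N : ℕ) (x : ℕ → S) => Scoring.gammaHat (fun i => f (x i)) N 0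
        * (2 * Scoring.tauIntWindow (Scoring.rhoHat (fun i => f (x i)) N) (W N)))
      atTop (fun _ => Scoring.autocov κ π (fun y => f y - ∫ z, f z ∂π) 0
        + 2 * ∑' t, Scoring.autocov κ π (fun y => f y - ∫ z, f z ∂π) (t + 1)) := by
  set P := Kernel.trajMeasure (X := fun _ : ℕ => S) μ₀
      (fun n : ℕ => κ.comap (fun h : (i : ↥(Finset.Iic n)) → S => h ⟨n, Finset.mem_Iic.2 le_rfl⟩)
        (measurable_pi_apply _)) with hP
  have hεtop : ε ≠ ∞ := ne_top_of_le_ne_top ENNReal.one_ne_top hε1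
  have hεpos : 0 < ε.toReal := ENNReal.toReal_pos hε0.ne' hεtop
  have hr0 : 0 ≤ 1 - ε.toReal :=
    sub_nonneg.2 (ENNReal.toReal_le_of_le_ofReal zero_le_one (by simpa using hε1))
  have hr1 : 1 - ε.toReal < 1 := sub_lt_self _ hεpos
  have hC0 : 0 ≤ C := (abs_nonneg _).trans (hC (Classical.choice (nonempty_of_isProbabilityMeasure μ₀)))
  set σ2 := Scoring.autocov κ π (fun y => f y - ∫ z, f z ∂π) 0
    + 2 * ∑' t, Scoring.autocov κ π (fun y => f y - ∫ z, f z ∂π) (t + 1) with hσ2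
  -- work with the windowed sum
  have hfun : (fun (N : ℕ) (x : ℕ → S) => Scoring.gammaHat (fun i => f (x i)) N 0
        * (2 * Scoring.tauIntWindow (Scoring.rhoHat (fun i => f (x i)) N) (W N)))
      = fun (N : ℕ) (x : ℕ → S) => Scoring.gammaHat (fun i => f (x i)) N 0
        + 2 * ∑ t ∈ range (W N), Scoring.gammaHat (fun i => f (x i)) N (t + 1) := by
    funext N x
    exact (gammaWindow_eq_gammaHat_mul_tauIntWindow (fun i => f (x i)) N (W N)).symm
  rw [hfun]
  have hstat_m : ∀ N, Measurable fun x : ℕ → S => Scoring.gammaHat (fun i => f (x i)) N 0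
      + 2 * ∑ t ∈ range (W N), Scoring.gammaHat (fun i => f (x i)) N (t + 1) := fun N =>
    (measurable_gammaHat_comp hf N 0).add
      ((Finset.measurable_sum _ fun t _ => measurable_gammaHat_comp hf N (t + 1)).const_mul 2)
  have hstat_b : ∀ N (x : ℕ → S), |Scoring.gammaHat (fun i => f (x i)) N 0
      + 2 * ∑ t ∈ range (W N), Scoring.gammaHat (fun i => f (x i)) N (t + 1)|
      ≤ (2 * C) ^ 2 + 2 * (W N * (2 * C) ^ 2) := by
    intro N x
    refine (abs_add_le _ _).trans (add_le_add (abs_gammaHat_comp_le hC x N 0) ?_)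
    rw [abs_mul, abs_two]
    refine mul_le_mul_of_nonneg_left ((Finset.abs_sum_le_sum_abs _ _).trans ?_) (by norm_num)
    calc ∑ t ∈ range (W N), |Scoring.gammaHat (fun i => f (x i)) N (t + 1)|
        ≤ ∑ t ∈ range (W N), (2 * C) ^ 2 := Finset.sum_le_sum fun t _ => abs_gammaHat_comp_le hC x N _
      _ = W N * (2 * C) ^ 2 := by rw [Finset.sum_const, Finset.card_range, nsmul_eq_mul]
  -- the mean-square bound tends to zero
  set K₀ := C ^ 4 * (2112 + 4224 * m / ε.toReal + 512 * (m / ε.toReal) ^ 2) with hK₀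
  have hK₀0 : 0 ≤ K₀ := by rw [hK₀]; positivity
  set bnd : ℕ → ℝ := fun N => 3 * K₀ / N + (12 * K₀ + 12288 * C ^ 4) * ((W N : ℝ) ^ 3 / N)
    + 768 * C ^ 4 * (m / ε.toReal) ^ 2 * (1 - ε.toReal) ^ (2 * ((W N + 1) / m)) with hbnd
  have hbnd_t : Tendsto bnd atTop (𝓝 0) := by
    have h1 : Tendsto (fun N : ℕ => 3 * K₀ / (N : ℝ)) atTop (𝓝 0) :=
      tendsto_const_nhds.div_atTop tendsto_natCast_atTop_atTop
    have h2 : Tendsto (fun N : ℕ => (12 * K₀ + 12288 * C ^ 4) * ((W N : ℝ) ^ 3 / N)) atTop (𝓝 0) := by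
      simpa using hW3.const_mul (12 * K₀ + 12288 * C ^ 4)
    have h3 : Tendsto (fun N : ℕ => 768 * C ^ 4 * (m / ε.toReal) ^ 2
        * (1 - ε.toReal) ^ (2 * ((W N + 1) / m))) atTop (𝓝 0) := by
      have hq : Tendsto (fun N : ℕ => 2 * ((W N + 1) / m)) atTop atTop := by
        have ha : Tendsto (fun N : ℕ => W N + 1) atTop atTop :=
          (Filter.tendsto_add_atTop_nat 1).comp hW
        exact Filter.Tendsto.const_mul_atTop' (by norm_num : (0 : ℕ) < 2)
          ((Nat.tendsto_div_const_atTop hm.ne').comp ha)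
      simpa using ((tendsto_pow_atTop_nhds_zero_of_lt_one hr0 hr1).comp hq).const_mul
        (768 * C ^ 4 * (m / ε.toReal) ^ 2)
    simpa [hbnd] using (h1.add h2).add h3
  -- eventually the window fits and `W ≥ 1`
  have hev : ∀ᶠ N in atTop, 2 * W N ≤ N ∧ 0 < N ∧ 1 ≤ W N := by
    have hsmall : ∀ᶠ N in atTop, (W N : ℝ) ^ 3 / N < 1 / 2 :=
      (tendsto_order.1 hW3).2 _ (by norm_num)
    filter_upwards [hsmall, hW.eventually_ge_atTop 1, Filter.eventually_gt_atTop 0] with N h1 h2 h3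
    refine ⟨?_, h3, h2⟩
    have hN' : (0 : ℝ) < N := by exact_mod_cast h3
    have hW1 : (1 : ℝ) ≤ W N := by exact_mod_cast h2
    have hle : (W N : ℝ) ≤ (W N : ℝ) ^ 3 := by
      have h := pow_le_pow_right₀ hW1 (show 1 ≤ 3 by norm_num)
      rwa [pow_one] at h
    have h4 : (W N : ℝ) / N < 1 / 2 := lt_of_le_of_lt (div_le_div_of_nonneg_right hle hN'.le) h1
    rw [div_lt_iff₀ hN'] at h4
    have : (2 * W N : ℕ) < (N : ℝ) + 1 := by push_cast; linarith
    exact_mod_cast Nat.lt_succ_iff.1 (by exact_mod_cast this)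
  rw [tendstoInMeasure_iff_measureReal_norm]
  intro δ hδ
  have hδ2 : 0 < δ ^ 2 := by positivity
  refine squeeze_zero' (Eventually.of_forall fun n => measureReal_nonneg)
    ?_ (by simpa using hbnd_t.div_const (δ ^ 2))
  filter_upwards [hev] with N hN
  obtain ⟨hWN, hN0, hW1⟩ := hN
  have hmse := chain_mse_gammaWindow_le_of_nHit μ₀ hmin hε0 hε1 hm hπ hf hC hWN hN0
  rw [← hP] at hmse
  -- Chebyshev on the squared error
  set D : (ℕ → S) → ℝ := fun x => Scoring.gammaHat (fun i => f (x i)) N 0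
      + 2 * ∑ t ∈ range (W N), Scoring.gammaHat (fun i => f (x i)) N (t + 1) - σ2 with hD
  have hDm : Measurable D := (hstat_m N).sub measurable_const
  have hset : {x : ℕ → S | δ ≤ ‖Scoring.gammaHat (fun i => f (x i)) N 0
      + 2 * ∑ t ∈ range (W N), Scoring.gammaHat (fun i => f (x i)) N (t + 1) - σ2‖}
      = {x | δ ^ 2 ≤ D x ^ 2} := by
    ext x
    simp only [Set.mem_setOf_eq, Real.norm_eq_abs]
    constructor
    · intro h
      calc δ ^ 2 ≤ |D x| ^ 2 := pow_le_pow_left₀ hδ.le h 2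
        _ = D x ^ 2 := sq_abs _
    · intro h
      have h' := Real.sqrt_le_sqrt h
      rw [Real.sqrt_sq hδ.le, Real.sqrt_sq_eq_abs] at h'
      exact h'
  rw [hset]
  have hiD2 : Integrable (fun x => D x ^ 2) P :=
    Scoring.integrable_of_bounded P (hDm.pow_const 2)
      (C := ((2 * C) ^ 2 + 2 * (W N * (2 * C) ^ 2) + |σ2|) ^ 2) fun x => by
        rw [abs_pow]
        refine pow_le_pow_left₀ (abs_nonneg _) ((abs_sub _ _).trans (add_le_add ?_ le_rfl)) 2
        exact hstat_b N x
  have hcheb := mul_meas_ge_le_integral_of_nonneg (μ := P) (ae_of_all _ fun x => sq_nonneg (D x))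
    hiD2 (δ ^ 2)
  have hN' : (0 : ℝ) < N := by exact_mod_cast hN0
  have hW1' : (1 : ℝ) ≤ W N := by exact_mod_cast hW1
  have hmse' : ∫ x, D x ^ 2 ∂P ≤ bnd N := by
    rw [← hK₀] at hmse
    refine hmse.trans ?_
    simp only [hbnd]
    have hW2 : (W N : ℝ) ^ 2 ≤ (W N : ℝ) ^ 3 := pow_le_pow_right₀ hW1' (show 2 ≤ 3 by norm_num)
    have h1 : (3 + 12 * (W N : ℝ) ^ 2) * K₀ / N ≤ 3 * K₀ / N + 12 * K₀ * ((W N : ℝ) ^ 3 / N) := by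
      rw [show (3 + 12 * (W N : ℝ) ^ 2) * K₀ / N = 3 * K₀ / N + 12 * K₀ * ((W N : ℝ) ^ 2 / N) by ring]
      exact add_le_add le_rfl (mul_le_mul_of_nonneg_left
        (div_le_div_of_nonneg_right hW2 hN'.le) (by positivity))
    have h2 : (12 * K₀ + 12288 * C ^ 4) * ((W N : ℝ) ^ 3 / N)
        = 12 * K₀ * ((W N : ℝ) ^ 3 / N) + 12288 * C ^ 4 * (W N : ℝ) ^ 3 / N := by ring
    linarith [h1, h2]
  calc P.real {x | δ ^ 2 ≤ D x ^ 2} ≤ (∫ x, D x ^ 2 ∂P) / δ ^ 2 := by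
        rw [le_div_iff₀ hδ2, mul_comm]; exact hcheb
    _ ≤ bnd N / δ ^ 2 := div_le_div_of_nonneg_right hmse' hδ2.le

end Chain

end Summit.Ventures.LatticeQCDFlow.Exactness.GeneralNCMC
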